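import Literature.AnabelianGeometry.AbsoluteAnabelian.AbsTopILem27iiiStepOfSigmaStarCorollaries
import Summits.ABC.IUTFork.MLFGaloisTFG
import Literature.AnabelianGeometry.AbsoluteAnabelian.AbsTopIThm26iiSigmaStarModel
import Literature.AnabelianGeometry.AbsoluteAnabelian.AbsTopIThm26SigmaStarAlmostProCorollaries
import HarnessLib

/-!
# [AbsTopI] Thm 2.6 (iii) and Thm 2.6 (v) (general form) from (∗)_Σ: the `G_k`-finite-generation input DISCHARGED

S. Mochizuki, *Topics in Absolute Anabelian Geometry I: Generalities* (2012) [AbsTopI], Thm 2.6 (iii)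
and (v), manuscript p. 22, proof p. 23–24.

abc-iut cell (block C, seat abc-iut-w6-d074; L4-lead RULING #8j (6) «HOOK-FROM-SIGMA-STAR»).  The
Literature side (`AbsTopILem27iiiStepOfSigmaStar{Prep,Character,Proofs,Corollaries}.lean`) proves the
typed Thm 2.6 (iii) (`E.Thm26iii S`, both clauses) and the general-`Θ` Thm 2.6 (v) (`E.Thm26vFull B`,
every `Σ ⊆ Primes`) from MLF base data, [AbsTopI] Prop 2.2 (`Δ` tfg), `Δ` pro-`Σ`, the splitting over
an open subgroup of `G`, condition (∗)_Σ, and "`Π` topologically finitely generated" — the last being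
Prop 2.2 plus "[NSW] Thm 7.5.10" for `G_k`, a theorem of the tree only Summits-side
(`Summit.ABC.IUTFork.isTopologicallyFinitelyGenerated_absoluteGaloisGroup_padic`, via Tate's local
Euler–Poincaré characteristic; abc-iut GAP G-L4t4-2).  This PROOF-ONLY file performs that discharge, as
`MLFGaloisTFG.lean` did for Thm 2.6 (ii) and `AbsTopIThm26vFullHolds.lean` for the `Σ ≠ Primes` regime
of (v):
* `FundamentalExtension.thm26iii_of_sigmaStarCondition'` — `E.Thm26iii S` from (B, Prop 2.2, `Δ`
  pro-`Σ`, splitting, (∗)_Σ) ONLY;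
* `FundamentalExtension.MLFBase.thm26vFull_of_sigmaStarCondition'` — `E.Thm26vFull B` for every
  `Σ ⊆ Primes` from the same inputs;
* `FundamentalExtension.MLFBase.thm26vFull_of_starCondition''` / `thm26iii_primes_of_starCondition'` —
  the `Σ = Primes` regime of [IUTchI–III] from print's (∗) ([AbsAnab] Lemma 1.1.4 (ii) hypotheses:
  MLF base, splitting, `Δ` tfg, (∗)) and nothing else.
HONEST FRAMING: refereed, undisputed [AbsTopI]; (∗)_Σ / (∗) and the splitting are hypotheses on data
whose geometric origin is not formalised; nothing here bears on [IUTchIII] Cor. 3.12; typed ≠ proved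
elsewhere.
-/

noncomputable section

namespace Summit.ABC.IUTFork

open Literature.AnabelianGeometry.AbsoluteAnabelian

/-- **[AbsTopI] Thm 2.6 (iii) (typed `E.Thm26iii S`, both clauses) with "`G_k` tfg" DISCHARGED**: for
every extension `1 → Δ → Π → G → 1` with MLF base data `G ≅ G_K`, GIVEN ONLY [AbsTopI] Prop 2.2 BY
NAME (`E.GeomTFG`), the construction datum "`Δ` pro-`Σ`", the splitting over an open subgroup of `G`,
and condition (∗)_Σ. [cite: MochizukiAbsTopI2012, Thm 2.6 (iii) p.22] -/
theorem _root_.Literature.AnabelianGeometry.AbsoluteAnabelian.FundamentalExtension.thm26iii_of_sigmaStarCondition'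
    {E : FundamentalExtension.{0}} (B : E.MLFBase) {S : Set ℕ} (hΔ : E.GeomTFG)
    (hΔS : IsProSet E.geom S) (hs : E.SplitsOverOpenSubgroup) (hstar : E.SigmaStarCondition S) :
    E.Thm26iii S :=
  FundamentalExtension.thm26iii_of_sigmaStarCondition_of_geomTFG B hΔ
    (FundamentalExtension.isTopologicallyFinitelyGenerated_gal_of_mlfBase B) hΔS hs hstar

/-- **[AbsTopI] Thm 2.6 (v), GENERAL form (`Θ`, `ζ̃`), every `Σ ⊆ Primes`, with "`G_k` tfg"
DISCHARGED**: `E.Thm26vFull B` from MLF base data, Prop 2.2, `Δ` pro-`Σ`, the splitting and (∗)_Σ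
only — including the regime `Σ = Primes` of [IUTchI–III]. [cite: MochizukiAbsTopI2012, Thm 2.6 (v) p.22] -/
theorem _root_.Literature.AnabelianGeometry.AbsoluteAnabelian.FundamentalExtension.MLFBase.thm26vFull_of_sigmaStarCondition'
    {E : FundamentalExtension.{0}} (B : E.MLFBase) (S : Set ℕ) (hS : S ⊆ {q | q.Prime})
    (hΔ : E.GeomTFG) (hΔS : IsProSet E.geom S) (hs : E.SplitsOverOpenSubgroup)
    (hstar : E.SigmaStarCondition S) : E.Thm26vFull B :=
  FundamentalExtension.MLFBase.thm26vFull_of_sigmaStarCondition B S hS hΔ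
    (IsTopologicallyFinitelyGenerated.of_extension E.aug E.aug_surjective hΔ
      (FundamentalExtension.isTopologicallyFinitelyGenerated_gal_of_mlfBase B)) hΔS hs hstar

/-- **[AbsTopI] Thm 2.6 (v), general form, `Σ = Primes`, from print's (∗) with "`G_k` tfg"
DISCHARGED**: the [AbsAnab] Lemma 1.1.4 (ii) hypotheses (MLF base data, splitting over an open subgroup,
`Δ` tfg, (∗)) give the typed `E.Thm26vFull B`. [cite: MochizukiAbsTopI2012, Thm 2.6 (v) p.22] -/
theorem _root_.Literature.AnabelianGeometry.AbsoluteAnabelian.FundamentalExtension.MLFBase.thm26vFull_of_starCondition''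
    {E : FundamentalExtension.{0}} (B : E.MLFBase) (hs : E.SplitsOverOpenSubgroup) (hΔ : E.GeomTFG)
    (hstar : E.StarCondition) : E.Thm26vFull B :=
  FundamentalExtension.MLFBase.thm26vFull_of_starCondition_of_splits B hs hΔ hstar
    (IsTopologicallyFinitelyGenerated.of_extension E.aug E.aug_surjective hΔ
      (FundamentalExtension.isTopologicallyFinitelyGenerated_gal_of_mlfBase B))

/-- **[AbsTopI] Thm 2.6 (iii) at `Σ = Primes` from print's (∗) with "`G_k` tfg" DISCHARGED.**
[cite: MochizukiAbsTopI2012, Thm 2.6 (iii) p.22] -/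
theorem _root_.Literature.AnabelianGeometry.AbsoluteAnabelian.FundamentalExtension.thm26iii_primes_of_starCondition'
    {E : FundamentalExtension.{0}} (B : E.MLFBase) (hΔ : E.GeomTFG) (hs : E.SplitsOverOpenSubgroup)
    (hstar : E.StarCondition) : E.Thm26iii {q | q.Prime} :=
  FundamentalExtension.thm26iii_primes_of_starCondition B hΔ
    (IsTopologicallyFinitelyGenerated.of_extension E.aug E.aug_surjective hΔ
      (FundamentalExtension.isTopologicallyFinitelyGenerated_gal_of_mlfBase B)) hs hstar

/-! ## Append (v2, 2026-08-26): closed non-vacuity at `Σ = Primes` -/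

/-- **Closed non-vacuity of the (∗)_Σ route to [AbsTopI] Thm 2.6 (iii)/(v)**: for every prime `p`
there is an extension with MLF base data (`G = G_{ℚ_p}`) and NONTRIVIAL `Δ` (the split model
`Ẑ × G_{ℚ_p}` of abc-iut-w5-d188's `exists_mlfBase_sigmaStar_hypotheses`: `Δ ≅ Ẑ` free pro-cyclic,
splitting, `Δ` tfg, (∗)_Σ at `Σ = Primes` with `m = 1`) satisfying the typed `Thm26iii Primes` and the
general-`Θ` `Thm26vFull` — obtained through `thm26iii_of_sigmaStarCondition'` /
`MLFBase.thm26vFull_of_sigmaStarCondition'`, zero hypotheses. [cite: MochizukiAbsTopI2012, Thm 2.6 (iii) p.22] -/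
theorem exists_mlfBase_geom_nontrivial_thm26iii_thm26vFull_of_sigmaStar (p : ℕ) [Fact p.Prime] :
    ∃ (E : FundamentalExtension.{0}) (B : E.MLFBase), Nontrivial E.geom ∧ E.GeomTFG ∧
      E.SplitsOverOpenSubgroup ∧ E.SigmaStarCondition {q | q.Prime} ∧
      E.Thm26iii {q | q.Prime} ∧ E.Thm26vFull B := by
  obtain ⟨E, B, -, -, hnt, hs, htfg, hstar⟩ :=
    FundamentalExtension.exists_mlfBase_sigmaStar_hypotheses {q | q.Prime} p ℚ_[p]
  have hΔS : IsProSet E.geom {q | q.Prime} := ⟨fun _ _ _ _ hq _ => hq⟩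
  exact ⟨E, B, hnt 2 Nat.prime_two Nat.prime_two, htfg, hs, hstar,
    FundamentalExtension.thm26iii_of_sigmaStarCondition' B htfg hΔS hs hstar,
    FundamentalExtension.MLFBase.thm26vFull_of_sigmaStarCondition' B _ subset_rfl htfg hΔS hs hstar⟩

/-! ## Append (v3, 2026-08-26): the almost-pro-`Σ` count forms with "`G_k` tfg" DISCHARGED -/

/-- **[AbsTopI] Thm 2.6 (iii) (typed, both clauses) for `Δ` ALMOST pro-`Σ` — print's Def 2.1 reading —
with "`G_k` tfg" DISCHARGED**: from MLF base data, Prop 2.2 (`E.GeomTFG`), `Δ` almost pro-`Σ`, the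
splitting over an open subgroup of `G` and (∗)_Σ ONLY. [cite: MochizukiAbsTopI2012, Thm 2.6 (iii) p.22] -/
theorem _root_.Literature.AnabelianGeometry.AbsoluteAnabelian.FundamentalExtension.thm26iii_of_sigmaStarCondition_of_isAlmostPro'
    {E : FundamentalExtension.{0}} (B : E.MLFBase) {S : Set ℕ} (hΔ : E.GeomTFG)
    (hpro : IsAlmostPro E.geom S) (hs : E.SplitsOverOpenSubgroup) (hstar : E.SigmaStarCondition S) :
    E.Thm26iii S :=
  FundamentalExtension.thm26iii_of_sigmaStarCondition_of_isAlmostPro_of_geomTFG B hΔ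
    (FundamentalExtension.isTopologicallyFinitelyGenerated_gal_of_mlfBase B) hpro hs hstar

/-- **[AbsTopI] Thm 2.6 (v), GENERAL form, every `Σ ⊆ Primes`, for `Δ` ALMOST pro-`Σ`, with "`G_k` tfg"
DISCHARGED**: from MLF base data, Prop 2.2, `Δ` almost pro-`Σ`, the splitting and (∗)_Σ only.
[cite: MochizukiAbsTopI2012, Thm 2.6 (v) p.22] -/
theorem _root_.Literature.AnabelianGeometry.AbsoluteAnabelian.FundamentalExtension.MLFBase.thm26vFull_of_sigmaStarCondition_of_isAlmostPro'
    {E : FundamentalExtension.{0}} (B : E.MLFBase) (S : Set ℕ) (hS : S ⊆ {q | q.Prime})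
    (hΔ : E.GeomTFG) (hΔS : IsAlmostPro E.geom S) (hs : E.SplitsOverOpenSubgroup)
    (hstar : E.SigmaStarCondition S) : E.Thm26vFull B :=
  FundamentalExtension.MLFBase.thm26vFull_of_sigmaStarCondition_of_isAlmostPro_of_geomTFG B S hS hΔ
    (FundamentalExtension.isTopologicallyFinitelyGenerated_gal_of_mlfBase B) hΔS hs hstar

end Summit.ABC.IUTFork
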